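import Literature.NumberTheory.LFunctions.RayClasses
import Literature.NumberTheory.Automorphic.IdeleIdealClass
import Literature.NumberTheory.GaloisRepresentations.HeckeCharacterProofs
import Mathlib.RingTheory.DedekindDomain.Factorization
import Mathlib.Data.Fintype.Pigeonhole
import HarnessLib

/-!
# Uniform principalisation in the narrow ray class `mod 𝔪`, with valuations (proved)

Topic `NumberTheory/GaloisRepresentations`; namespace
`Literature.NumberTheory.GaloisRepresentations`.  A *proofs* file (theorems only; no definition,
no named fact, no instance).

For a nonzero module `𝔪` of the number field `K` the narrow ray classes `mod 𝔪` are finite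
(tree `LFunctions.finite_rayClassQuotient`, Neukirch VI (1.8)); hence (pigeonhole on the powers of
a class):

* `exists_uniform_rayClass_principalization` — **there is `H ≥ 1` such that for every nonzero
  ideal `𝔞` prime to `𝔪`, `𝔞^H = (b/c)` with `b, c ∈ 𝓞 K ∖ 0`, `c` prime to `𝔪`, `b ≡ c mod 𝔪`**
  (`(c) 𝔞^H = (b)`; `H = (#classes)!` works uniformly);
* `valuation_div_eq_of_span_mul_pow_eq` — from `(c) 𝔭^H = (b)`: `|b/c|_w = q_w^{-H[w = 𝔭]}`
  (Mathlib `FractionalIdeal.count`, tree `FractionalIdeal.count_spanSingleton_eq_neg_log_valuation`);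
* `valued_div_sub_one_le` — `b ≡ c mod 𝔭_w^m`, `c ∉ 𝔭_w` ⟹ `|b/c - 1|_w ≤ |ϖ_w|^m` in `K_w`.

These supply, in the proof of Böckle–Hui's Thm. 1.1 for a general number field (Step 4,
Prop. 2.12), the global element `π = b/c` with `(π) = 𝔭_v^H` and `π ≡ 1` at the places above `ℓ`,
at which a locally algebraic idele class character can be evaluated (Serre's argument, *Abelian
ℓ-adic representations*, Ch. II §2.7 / III §3: "`φ(x)` for `x` in a subgroup of finite index of the
`S`-units").

## References

* J. Neukirch, *Algebraic Number Theory* (1999), Ch. VI §1, Def. (1.7), Prop. (1.8).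
  [NeukirchANT1999]
* J.-P. Serre, *Abelian ℓ-adic representations and elliptic curves* (1968), Ch. II §2.7.
  [SerreAbelianLadic1968]
-/

noncomputable section

open scoped NumberField nonZeroDivisors
open NumberField IsDedekindDomain IsDedekindDomain.HeightOneSpectrum
open Literature.NumberTheory.LFunctions Literature.NumberTheory.Automorphic

namespace Literature.NumberTheory.GaloisRepresentations

variable {K : Type*} [Field K] [NumberField K]

/-! ### Pigeonhole in the narrow ray class quotient -/

/-- **Two powers of an ideal prime to `𝔪` lie in the same narrow ray class `mod 𝔪`**: among
`𝔞⁰, …, 𝔞ᶜ` (`c` the number of classes) two are related. [cite: NeukirchANT1999, Ch. VI §1 Prop. (1.8)] -/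
theorem exists_rayClassRel_pow_pow {𝔪 : Ideal (𝓞 K)} (h𝔪 : 𝔪 ≠ ⊥) {𝔞 : Ideal (𝓞 K)}
    (h𝔞 : 𝔞 ≠ ⊥) (hcop : IsCoprime 𝔞 𝔪) :
    ∃ i j : ℕ, i < j ∧ j ≤ Nat.card (Quotient (rayClassSetoid 𝔪)) ∧
      RayClassRel 𝔪 (𝔞 ^ i) (𝔞 ^ j) := by
  classical
  haveI : Finite (Quotient (rayClassSetoid 𝔪)) := finite_rayClassQuotient h𝔪
  haveI : Fintype (Quotient (rayClassSetoid 𝔪)) := Fintype.ofFinite _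
  set c : ℕ := Nat.card (Quotient (rayClassSetoid 𝔪)) with hc
  -- the classes of `𝔞^i`, `i ≤ c`
  let A : Fin (c + 1) → CoprimeIdeal 𝔪 := fun i =>
    ⟨𝔞 ^ (i : ℕ), pow_ne_zero _ h𝔞, IsCoprime.pow_left hcop⟩
  let f : Fin (c + 1) → Quotient (rayClassSetoid 𝔪) := fun i => Quotient.mk _ (A i)
  have hcard : Fintype.card (Quotient (rayClassSetoid 𝔪)) < Fintype.card (Fin (c + 1)) := by
    rw [Fintype.card_fin, ← Nat.card_eq_fintype_card]
    omega
  obtain ⟨i, j, hij, hfij⟩ := Fintype.exists_ne_map_eq_of_card_lt f hcard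
  -- orient `i < j`
  wlog hlt : (i : ℕ) < j generalizing i j
  · have hji : (j : ℕ) < i := lt_of_le_of_ne (not_lt.mp hlt) fun h => hij (Fin.ext h).symm
    exact this j i hij.symm hfij.symm hji
  refine ⟨i, j, hlt, Nat.lt_succ_iff.mp j.2, ?_⟩
  have hrel : (rayClassSetoid 𝔪).r (A i) (A j) := Quotient.exact hfij
  rw [rayClassSetoid_r_iff] at hrel
  -- `hrel : RayClassRel 𝔪 (𝔞^j) (𝔞^i)`
  exact hrel.symm

/-- **Uniform principalisation in the narrow ray class `mod 𝔪`.**  There is `H ≥ 1` such that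
for every nonzero ideal `𝔞` prime to `𝔪` there are nonzero `b, c ∈ 𝓞 K` with `c` prime to `𝔪`,
`b - c ∈ 𝔪` and `(c) · 𝔞^H = (b)` (i.e. `𝔞^H = (b/c)` with `b/c ≡ 1 mod^× 𝔪`).  (Pigeonhole gives
`(c) 𝔞^d = (b)` for some `1 ≤ d ≤ #classes`; raise to the power `#classes!/d`.)
[cite: NeukirchANT1999, Ch. VI §1 Prop. (1.8)] -/
theorem exists_uniform_rayClass_principalization {𝔪 : Ideal (𝓞 K)} (h𝔪 : 𝔪 ≠ ⊥) :
    ∃ H : ℕ, 0 < H ∧ ∀ 𝔞 : Ideal (𝓞 K), 𝔞 ≠ ⊥ → IsCoprime 𝔞 𝔪 →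
      ∃ b c : 𝓞 K, b ≠ 0 ∧ c ≠ 0 ∧ IsCoprime (Ideal.span {c}) 𝔪 ∧ b - c ∈ 𝔪 ∧
        Ideal.span {c} * 𝔞 ^ H = Ideal.span {b} := by
  classical
  set N : ℕ := Nat.card (Quotient (rayClassSetoid 𝔪)) with hN
  refine ⟨N.factorial, Nat.factorial_pos N, fun 𝔞 h𝔞 hcop => ?_⟩
  obtain ⟨i, j, hij, hjN, b, c, hb, hc, hccop, hbc, -, heq⟩ :=
    exists_rayClassRel_pow_pow h𝔪 h𝔞 hcop
  -- `heq : (c) 𝔞^j = (b) 𝔞^i`; cancel `𝔞^i`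
  set d : ℕ := j - i with hd
  have hd0 : 0 < d := by omega
  have hjd : j = d + i := by omega
  have heq' : Ideal.span {c} * 𝔞 ^ d = Ideal.span {b} := by
    have h1 : Ideal.span {c} * 𝔞 ^ d * 𝔞 ^ i = Ideal.span {b} * 𝔞 ^ i := by
      rw [mul_assoc, ← pow_add, ← hjd, heq]
    exact mul_right_cancel₀ (pow_ne_zero i h𝔞) h1
  -- raise to the power `t = N!/d`
  obtain ⟨t, ht⟩ : d ∣ N.factorial := Nat.dvd_factorial hd0 (by omega)
  refine ⟨b ^ t, c ^ t, pow_ne_zero t hb, pow_ne_zero t hc, ?_, ?_, ?_⟩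
  · rw [← Ideal.span_singleton_pow]
    exact IsCoprime.pow_left hccop
  · obtain ⟨q, hq⟩ := sub_dvd_pow_sub_pow b c t
    rw [hq]
    exact Ideal.mul_mem_right q 𝔪 hbc
  · rw [← Ideal.span_singleton_pow, ← Ideal.span_singleton_pow, ht, pow_mul, ← mul_pow, heq']

/-! ### Valuations of `b/c` from `(c) 𝔭^H = (b)` -/

/-- The count of `(x)` at `w` is `-log |x|_w` for `x ∈ 𝓞 K ∖ 0` (tree
`FractionalIdeal.count_spanSingleton_eq_neg_log_valuation`). [folklore] -/
theorem count_coeIdeal_span_singleton_eq (w : HeightOneSpectrum (𝓞 K)) {x : 𝓞 K} (hx : x ≠ 0) :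
    FractionalIdeal.count K w ((Ideal.span {x} : Ideal (𝓞 K)) : FractionalIdeal (𝓞 K)⁰ K) =
      -WithZero.log (w.valuation K (x : K)) := by
  have hx' : (x : K) ≠ 0 := by exact_mod_cast hx
  have h := FractionalIdeal.count_spanSingleton_eq_neg_log_valuation (R := 𝓞 K) (K := K) w
    (Units.mk0 (x : K) hx')
  rw [Units.val_mk0] at h
  rw [FractionalIdeal.coeIdeal_span_singleton]
  exact h

open scoped Classical in
/-- **`|b/c|_w = q_w^{-H [w = 𝔭]}` when `(c) 𝔭^H = (b)`.** [folklore] -/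
theorem valuation_div_eq_of_span_mul_pow_eq (v : HeightOneSpectrum (𝓞 K)) {H : ℕ} {b c : 𝓞 K}
    (hb : b ≠ 0) (hc : c ≠ 0) (heq : Ideal.span {c} * v.asIdeal ^ H = Ideal.span {b})
    (w : HeightOneSpectrum (𝓞 K)) :
    w.valuation K ((b : K) / c) = if w = v then WithZero.exp (-(H : ℤ)) else 1 := by
  classical
  have hb' : (b : K) ≠ 0 := by exact_mod_cast hb
  have hc' : (c : K) ≠ 0 := by exact_mod_cast hc
  -- counts of both sides at `w`
  have hcount : FractionalIdeal.count K w
      (((Ideal.span {c} * v.asIdeal ^ H : Ideal (𝓞 K)) : FractionalIdeal (𝓞 K)⁰ K)) =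
      FractionalIdeal.count K w (((Ideal.span {b} : Ideal (𝓞 K)) : FractionalIdeal (𝓞 K)⁰ K)) := by
    rw [heq]
  have hcne : ((Ideal.span {c} : Ideal (𝓞 K)) : FractionalIdeal (𝓞 K)⁰ K) ≠ 0 := by
    rw [Ne, FractionalIdeal.coeIdeal_eq_zero, Ideal.span_singleton_eq_bot]
    exact hc
  have hvne : ((v.asIdeal ^ H : Ideal (𝓞 K)) : FractionalIdeal (𝓞 K)⁰ K) ≠ 0 := by
    rw [Ne, FractionalIdeal.coeIdeal_eq_zero]
    exact pow_ne_zero H v.ne_bot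
  rw [FractionalIdeal.coeIdeal_mul, FractionalIdeal.count_mul K w hcne hvne,
    FractionalIdeal.coeIdeal_pow, FractionalIdeal.count_pow,
    count_coeIdeal_span_singleton_eq w hc, count_coeIdeal_span_singleton_eq w hb] at hcount
  -- the count of `𝔭` at `w`
  have hpw : FractionalIdeal.count K w ((v.asIdeal : Ideal (𝓞 K)) : FractionalIdeal (𝓞 K)⁰ K) =
      if w = v then 1 else 0 := by
    split_ifs with h
    · subst h
      exact FractionalIdeal.count_self K w
    · exact FractionalIdeal.count_maximal_coprime K w (Ne.symm h)
  rw [hpw] at hcount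
  -- solve for `log |b/c|_w`
  have hvb : w.valuation K (b : K) ≠ 0 := (Valuation.ne_zero_iff _).mpr hb'
  have hvc : w.valuation K (c : K) ≠ 0 := (Valuation.ne_zero_iff _).mpr hc'
  have hval : w.valuation K ((b : K) / c) ≠ 0 := (Valuation.ne_zero_iff _).mpr (div_ne_zero hb' hc')
  rw [← WithZero.exp_log hval, map_div₀, WithZero.log_div hvb hvc]
  split_ifs at hcount ⊢ with h
  · congr 1
    linarith
  · rw [← WithZero.exp_zero]
    congr 1
    linarith

/-! ### Congruences `b ≡ c` in the completion -/

/-- **`b ≡ c mod 𝔭_w^m` with `c ∉ 𝔭_w` gives `|b/c - 1|_w ≤ |ϖ_w|^m` in `K_w`.** [folklore] -/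
theorem valued_div_sub_one_le (w : HeightOneSpectrum (𝓞 K)) {b c : 𝓞 K} {m : ℕ}
    (hbc : b - c ∈ w.asIdeal ^ m) (hc : c ∉ w.asIdeal) :
    Valued.v (algebraMap K (w.adicCompletion K) ((b : K) / c) - 1) ≤ WithZero.exp (-(m : ℤ)) := by
  have hc0 : c ≠ 0 := fun h0 => hc (h0 ▸ w.asIdeal.zero_mem)
  have hc' : (c : K) ≠ 0 := by exact_mod_cast hc0
  have e : algebraMap K (w.adicCompletion K) ((b : K) / c) - 1 =
      algebraMap K (w.adicCompletion K) (((b - c : 𝓞 K) : K) / c) := by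
    rw [← map_one (algebraMap K (w.adicCompletion K)), ← map_sub]
    congr 1
    push_cast
    field_simp
  rw [e, valued_algebraMap_adicCompletion, map_div₀]
  have h1 : w.valuation K ((b - c : 𝓞 K) : K) ≤ WithZero.exp (-(m : ℤ)) := by
    rw [show ((b - c : 𝓞 K) : K) = algebraMap (𝓞 K) K (b - c) from rfl, valuation_of_algebraMap]
    exact (w.intValuation_le_pow_iff_mem (b - c) m).mpr hbc
  have h2 : w.valuation K (c : K) = 1 := by
    rw [show ((c : 𝓞 K) : K) = algebraMap (𝓞 K) K c from rfl, valuation_eq_one_iff_notMem]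
    exact hc
  rw [h2, div_one]
  exact h1

omit [NumberField K] in
/-- An element prime to `𝔪` is a unit at every prime containing `𝔪`. [folklore] -/
theorem not_mem_of_isCoprime_span_of_le {c : 𝓞 K} {𝔪 : Ideal (𝓞 K)} (w : HeightOneSpectrum (𝓞 K))
    (hcop : IsCoprime (Ideal.span {c}) 𝔪) (hle : 𝔪 ≤ w.asIdeal) : c ∉ w.asIdeal := by
  intro hcw
  have h1 : Ideal.span {c} ⊔ 𝔪 ≤ w.asIdeal :=
    sup_le ((Ideal.span_singleton_le_iff_mem _).mpr hcw) hle
  rw [Ideal.isCoprime_iff_sup_eq.mp hcop] at h1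
  exact w.isPrime.ne_top (top_le_iff.mp h1)

omit [NumberField K] in
/-- A finite product of prime powers is contained in each factor. [folklore] -/
theorem prod_pow_le_pow (L : Finset (HeightOneSpectrum (𝓞 K))) (m : ℕ) {w : HeightOneSpectrum (𝓞 K)}
    (hw : w ∈ L) : (∏ u ∈ L, u.asIdeal ^ m) ≤ w.asIdeal ^ m :=
  Ideal.le_of_dvd (Finset.dvd_prod_of_mem (fun u : HeightOneSpectrum (𝓞 K) => u.asIdeal ^ m) hw)

omit [NumberField K] in
/-- A finite product of prime powers is nonzero. [folklore] -/
theorem prod_pow_ne_bot (L : Finset (HeightOneSpectrum (𝓞 K))) (m : ℕ) :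
    (∏ u ∈ L, u.asIdeal ^ m) ≠ (⊥ : Ideal (𝓞 K)) := by
  have h : (∏ u ∈ L, u.asIdeal ^ m) ≠ (0 : Ideal (𝓞 K)) :=
    Finset.prod_ne_zero_iff.mpr fun u _ => pow_ne_zero m (by
      rw [Ne, Ideal.zero_eq_bot]
      exact u.ne_bot)
  rwa [Ne, Ideal.zero_eq_bot] at h

/-- A prime outside `L` is prime to `∏_{u ∈ L} 𝔭_u^m`. [folklore] -/
theorem isCoprime_prod_pow_of_not_mem (L : Finset (HeightOneSpectrum (𝓞 K))) (m : ℕ)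
    {v : HeightOneSpectrum (𝓞 K)} (hv : v ∉ L) : IsCoprime v.asIdeal (∏ u ∈ L, u.asIdeal ^ m) := by
  refine IsCoprime.prod_right fun u hu => IsCoprime.pow_right ?_
  have hne : v ≠ u := fun h => hv (h ▸ hu)
  rw [Ideal.isCoprime_iff_sup_eq]
  exact (v.isMaximal.coprime_of_ne u.isMaximal fun h => hne (HeightOneSpectrum.ext h))

end Literature.NumberTheory.GaloisRepresentations
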